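import Literature.NumberTheory.EllipticCurves.LatticeInclusionIsogenyRepresentationProofs
import Literature.NumberTheory.EllipticCurves.IsogenyComplexUniformizationProofs
import Literature.NumberTheory.EllipticCurves.IsogenyMultiplierDegreeProofs
import Literature.NumberTheory.EllipticCurves.LatticeHomOfCurveKernelProofs
import HarnessLib

/-!
# The `ℚ`-isogeny of a rational lattice inclusion `cΛ₁ ⊆ Λ₂` is `z ↦ cz` on ALL complex points;
# `#ker φ_ℂ = deg φ = [Λ₂ : cΛ₁]`, and the degree is odd when an odd multiple of `Λ₂` lies in `cΛ₁`

Topic `NumberTheory/EllipticCurves`; a proofs-only file (theorems only: no definitions, no named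
facts, nothing restated; D-0026), sibling of `LatticeInclusionIsogenyRepresentationProofs.lean`
(the construction with `j_*(φ m) = u₂(cz)` on algebraic points exported),
`LatticeInclusionIsogenyDegreeProofs.lean` (the same construction with a general embedding `j` and
the degree `deg φ = [c⁻¹Λ₂ : Λ₁]` via torsion counting) and `NeronIsogenyScalingProofs.lean`.
For Weierstrass models `W₁, W₂/ℚ` of elliptic curves with Néron-type period pairs `L₁, L₂` and
`c ∈ ℚˣ` with `cΛ₁ ⊆ Λ₂` (Silverman, *AEC*, Thm. VI.4.1(b): the analytic isogeny
`z ↦ cz : ℂ/Λ₁ → ℂ/Λ₂`), what this file adds to its siblings: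

* `exists_isogeny_baseChange_apply_eq_of_forall_mul_mem_lattice` — for given uniformisations
  `u₁, u₂` of the two models there is a `ℚ`-isogeny `φ : W₁ → W₂` with **`φ_ℂ(u₁ z) = u₂(cz)`
  for EVERY `z ∈ ℂ`** (not only at algebraic points), **`#ker φ_ℂ = [Λ₂ : cΛ₁]`** and
  **`deg φ = [Λ₂ : cΛ₁]`** (as `AddSubgroup.relIndex` of `cΛ₁ = (L₁.mulLeft c).lattice` in `Λ₂`).
  From algebraic to all complex points WITHOUT torsion counting: `φ_ℂ(u₁ z) = u₂(αz)` for some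
  `α` with `αΛ₁ ⊆ Λ₂` (`Isogeny.exists_mul_baseChange_apply_eq`); the two representations agree
  on `G = u₁⁻¹(j_* W₁(ℚ̄)) ⊇ Λ₁`, so `(α − c)G ⊆ Λ₂`; were `α ≠ c`, `G` would sit inside the
  lattice `(α − c)⁻¹Λ₂`, of finite index over `Λ₁` (`PeriodPair.relIndex_mulLeft_ne_zero`), and
  `W₁(ℚ̄) ↪ G/Λ₁` would be finite — it is infinite; so `α = c`.  The kernel count is that of
  `Isogeny.exists_mul_baseChange_apply_eq`, the degree is `Isogeny.natCard_ker_baseChange_eq_degree`.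
* `exists_isogeny_degree_eq_relIndex_of_isNeronLatticeOf` — packaged over the tree's
  `IsNeronLatticeOf` binders (uniformisations supplied by `PeriodPair.exists_addMonoidHom_of_g₂_g₃'`):
  a `ℚ`-isogeny `φ` with `deg φ = [Λ₂ : cΛ₁]` whose complex kernel is `{u₁ z : cz ∈ Λ₂}` for a
  surjective uniformisation `u₁` with kernel `Λ₁`.
* `exists_isogeny_odd_degree_of_isNeronLatticeOf` — if moreover `n·Λ₂ ⊆ cΛ₁` with `n` ODD, then
  there is a `ℚ`-isogeny `W₁ → W₂` of ODD degree (`ker φ_ℂ` is killed by `n`; Cauchy).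

Use (cell `bsd-rank2`, route `EisensteinDepletionAtTwo`, crux `StarOptBNSF`, line `nsf` v8/v9):
the odd-degree `ℚ`-isogeny from the `X₀(N)`-optimal curve `ℂ/qΛ_f` to the `X₁(N)`-optimal curve
`ℂ/c₁Λ₁(f)` at a level with a traceless prime `p` (`pΛ_f ⊆ Λ₁(f) ⊆ Λ_f`), multiplier `pc₁/q`,
`n = p`.

## References

* [SilvermanAEC2009] J. H. Silverman, *The Arithmetic of Elliptic Curves*, 2nd ed., GTM 106,
  Springer 2009: Thm. VI.4.1(b) (PDF pp. 152–154), Prop. VI.3.6(b), III.4.10(c) (PDF p. 72).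
-/

noncomputable section

open scoped Classical
open Complex Set Filter Topology
open Literature.NumberTheory.EllipticCurves

namespace Literature.NumberTheory.EllipticCurves

open _root_.WeierstrassCurve _root_.PeriodPair

variable [Algebra (AlgebraicClosure ℚ) ℂ] [IsScalarTower ℚ (AlgebraicClosure ℚ) ℂ]

/-! ### All complex points; kernel and degree -/

/-- **Silverman, *AEC*, Thm. VI.4.1(b), converse direction over `ℚ`, with the degree clause.**
Let `W₁, W₂/ℚ` be elliptic curves with Néron-type period pairs `L₁, L₂` (`g₂ = c₄/12`,
`g₃ = c₆/216`), uniformisations `u₁` (surjective, kernel `Λ₁`) and `u₂` (kernel `Λ₂`) in the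
coordinates of the models, and `c ∈ ℚˣ` with `cΛ₁ ⊆ Λ₂`.  Then there is a `ℚ`-isogeny
`φ : W₁ → W₂` with `φ_ℂ(u₁ z) = u₂(cz)` for ALL `z ∈ ℂ`, `#ker φ_ℂ = [Λ₂ : cΛ₁]`, and
`deg φ = [Λ₂ : cΛ₁]` (`AddSubgroup.relIndex` of `cΛ₁ = (L₁.mulLeft c).lattice` in `Λ₂`).
[cite: SilvermanAEC2009, Thm. VI.4.1] -/
theorem exists_isogeny_baseChange_apply_eq_of_forall_mul_mem_lattice
    {W₁ W₂ : WeierstrassCurve ℚ} [W₁.IsElliptic] [W₂.IsElliptic] {L₁ L₂ : PeriodPair}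
    (h₁₂ : L₁.g₂ = (W₁.baseChange ℂ).c₄ / 12) (h₁₃ : L₁.g₃ = (W₁.baseChange ℂ).c₆ / 216)
    (h₂₂ : L₂.g₂ = (W₂.baseChange ℂ).c₄ / 12) (h₂₃ : L₂.g₃ = (W₂.baseChange ℂ).c₆ / 216)
    {u₁ : ℂ →+ (W₁.baseChange ℂ).toAffine.Point} (hker₁ : (u₁.ker : Set ℂ) = L₁.lattice)
    (hsurj₁ : Function.Surjective u₁)
    (hu₁ : ∀ z ∉ L₁.lattice, ∃ hz, u₁ z = .some (℘[L₁] z - (W₁.baseChange ℂ).b₂ / 12)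
        ((℘'[L₁] z - (W₁.baseChange ℂ).a₁ * (℘[L₁] z - (W₁.baseChange ℂ).b₂ / 12) -
          (W₁.baseChange ℂ).a₃) / 2) hz)
    {u₂ : ℂ →+ (W₂.baseChange ℂ).toAffine.Point} (hker₂ : (u₂.ker : Set ℂ) = L₂.lattice)
    (hu₂ : ∀ z ∉ L₂.lattice, ∃ hz, u₂ z = .some (℘[L₂] z - (W₂.baseChange ℂ).b₂ / 12)
        ((℘'[L₂] z - (W₂.baseChange ℂ).a₁ * (℘[L₂] z - (W₂.baseChange ℂ).b₂ / 12) -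
          (W₂.baseChange ℂ).a₃) / 2) hz)
    {c : ℚ} (hc : c ≠ 0) (hle : ∀ z ∈ L₁.lattice, (c : ℂ) * z ∈ L₂.lattice) :
    ∃ φ : Isogeny W₁ W₂, (∀ z, φ.baseChange (u₁ z) = u₂ ((c : ℂ) * z)) ∧
      Nat.card (φ.baseChange (M := ℂ)).ker =
        (L₁.mulLeft (c : ℂ) (by exact_mod_cast hc)).lattice.toAddSubgroup.relIndex
          L₂.lattice.toAddSubgroup ∧
      φ.degree =
        (L₁.mulLeft (c : ℂ) (by exact_mod_cast hc)).lattice.toAddSubgroup.relIndex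
          L₂.lattice.toAddSubgroup := by
  have hcC : (c : ℂ) ≠ 0 := by exact_mod_cast hc
  have hu₁0 : ∀ z, u₁ z = 0 ↔ z ∈ L₁.lattice := fun z ↦ by
    rw [← SetLike.mem_coe, ← hker₁, SetLike.mem_coe, AddMonoidHom.mem_ker]
  have hu₂0 : ∀ z, u₂ z = 0 ↔ z ∈ L₂.lattice := fun z ↦ by
    rw [← SetLike.mem_coe, ← hker₂, SetLike.mem_coe, AddMonoidHom.mem_ker]
  -- the isogeny, `z ↦ cz` on algebraic points
  obtain ⟨φ, hrep⟩ := exists_isogeny_map_eq_uniformize_mul_of_forall_mul_mem_lattice h₁₂ h₁₃ h₂₂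
    h₂₃ hker₁ hsurj₁ hu₁ hker₂ hu₂ hc hle
  -- its analytic multiplier `α` on all complex points
  obtain ⟨α, hα, hαΛ, happ, hcard⟩ :=
    φ.exists_mul_baseChange_apply_eq h₁₂ h₁₃ h₂₂ h₂₃ u₁ hker₁ hu₁ u₂ hker₂ hu₂
  set jW₁ := (Affine.Point.map (W' := W₁) (IsScalarTower.toAlgHom ℚ (AlgebraicClosure ℚ) ℂ) :
    W₁.geomPoints →+ (W₁.baseChange ℂ).toAffine.Point) with hjW₁
  have hj₁ : Function.Injective jW₁ := Affine.Point.map_injective (W' := W₁) _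
  have hbc : ∀ P : W₁.geomPoints, φ.baseChange (M := ℂ) (jW₁ P) =
      Affine.Point.map (IsScalarTower.toAlgHom ℚ (AlgebraicClosure ℚ) ℂ) (φ P) :=
    fun P ↦ φ.baseChange_map P
  -- `(α - c) z ∈ Λ₂` whenever `u₁ z` is algebraic
  have key : ∀ (m : W₁.geomPoints) (z : ℂ), jW₁ m = u₁ z → (α - c) * z ∈ L₂.lattice := by
    intro m z hm
    have h1 : Affine.Point.map (IsScalarTower.toAlgHom ℚ (AlgebraicClosure ℚ) ℂ) (φ m) =
        u₂ ((c : ℂ) * z) := hrep m z hm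
    have h2 : φ.baseChange (u₁ z) = u₂ (α * z) := happ z
    rw [← show jW₁ m = u₁ z from hm, hbc] at h2
    rw [← hu₂0, sub_mul, map_sub, ← h2, h1, sub_self]
  -- `α = c`
  have hαc : α = (c : ℂ) := by
    by_contra hne
    have hβ : α - (c : ℂ) ≠ 0 := sub_ne_zero.mpr hne
    have hβΛ : ∀ l ∈ L₁.lattice, (α - c) * l ∈ L₂.lattice := fun l hl ↦ by
      rw [sub_mul]; exact sub_mem (hαΛ l hl) (hle l hl)
    -- `A = (α - c)⁻¹Λ₂ ⊇ Λ₁`, of finite index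
    set A : AddSubgroup ℂ := L₂.lattice.toAddSubgroup.comap (AddMonoidHom.mulLeft (α - c)) with hA
    have hmemA : ∀ z, z ∈ A ↔ (α - c) * z ∈ L₂.lattice := fun z ↦ Iff.rfl
    set H : AddSubgroup A := L₁.lattice.toAddSubgroup.addSubgroupOf A with hH
    have hidx : H.index ≠ 0 := by
      have h := relIndex_mulLeft_ne_zero hβ (mulLeft_lattice_le_of_forall_mul_mem hβ hβΛ)
      rwa [relIndex_mulLeft_eq_relIndex_comap hβ] at h
    haveI : Finite (A ⧸ H) := (AddSubgroup.fintypeOfIndexNeZero hidx).finite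
    -- the injection `W₁(ℚ̄) ↪ A/Λ₁`
    have hz : ∀ m : W₁.geomPoints, ∃ z : ℂ, u₁ z = jW₁ m := fun m ↦ hsurj₁ (jW₁ m)
    choose zOf hzOf using hz
    have hzA : ∀ m, zOf m ∈ A := fun m ↦ (hmemA _).mpr (key m (zOf m) (hzOf m).symm)
    set f : W₁.geomPoints → A ⧸ H := fun m ↦ QuotientAddGroup.mk ⟨zOf m, hzA m⟩ with hf
    have hfinj : Function.Injective f := by
      intro m m' hmm'
      have h := (QuotientAddGroup.eq.mp hmm')
      rw [hH, AddSubgroup.mem_addSubgroupOf] at h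
      have h' : -zOf m + zOf m' ∈ L₁.lattice := h
      have h0 : u₁ (-zOf m + zOf m') = 0 := (hu₁0 _).mpr h'
      rw [map_add, map_neg, neg_add_eq_zero, hzOf, hzOf] at h0
      exact hj₁ h0
    haveI : Finite W₁.geomPoints := Finite.of_injective f hfinj
    exact not_finite W₁.geomPoints
  subst hαc
  refine ⟨φ, happ, hcard, ?_⟩
  rw [← hcard, Isogeny.natCard_ker_baseChange_eq_degree]

/-! ### Packaged over `IsNeronLatticeOf`; oddness of the degree -/

/-- **A `ℚ`-isogeny of degree `[Λ₂ : cΛ₁]` from a rational lattice inclusion `cΛ₁ ⊆ Λ₂`.**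
For elliptic `W₁, W₂/ℚ` with Néron-type period pairs `L₁, L₂` (`IsNeronLatticeOf`) and
`c ∈ ℚˣ` with `cΛ₁ ⊆ Λ₂` there are a `ℚ`-isogeny `φ : W₁ → W₂` with `deg φ = [Λ₂ : cΛ₁]` and a
surjective uniformisation `u₁ : ℂ → W₁(ℂ)` with kernel `Λ₁` such that the complex kernel of `φ`
is `{u₁ z : cz ∈ Λ₂}` (Silverman, *AEC*, Thm. VI.4.1(b): `ker(z ↦ cz) = c⁻¹Λ₂/Λ₁`).
[cite: SilvermanAEC2009, Thm. VI.4.1] -/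
theorem exists_isogeny_degree_eq_relIndex_of_isNeronLatticeOf
    {W₁ W₂ : WeierstrassCurve ℚ} [W₁.IsElliptic] [W₂.IsElliptic] {L₁ L₂ : PeriodPair}
    (hL₁ : ModularForms.IsNeronLatticeOf (W₁.baseChange ℂ) L₁)
    (hL₂ : ModularForms.IsNeronLatticeOf (W₂.baseChange ℂ) L₂)
    {c : ℚ} (hc : c ≠ 0) (hle : ∀ z ∈ L₁.lattice, (c : ℂ) * z ∈ L₂.lattice) :
    ∃ (φ : Isogeny W₁ W₂) (u₁ : ℂ →+ (W₁.baseChange ℂ).toAffine.Point),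
      (u₁.ker : Set ℂ) = L₁.lattice ∧ Function.Surjective u₁ ∧
      (∀ z, φ.baseChange (u₁ z) = 0 ↔ (c : ℂ) * z ∈ L₂.lattice) ∧
      φ.degree =
        (L₁.mulLeft (c : ℂ) (by exact_mod_cast hc)).lattice.toAddSubgroup.relIndex
          L₂.lattice.toAddSubgroup := by
  obtain ⟨u₁, hker₁, hsurj₁, hu₁⟩ := L₁.exists_addMonoidHom_of_g₂_g₃' hL₁.1 hL₁.2
  obtain ⟨u₂, hker₂, -, hu₂⟩ := L₂.exists_addMonoidHom_of_g₂_g₃' hL₂.1 hL₂.2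
  have hu₂0 : ∀ z, u₂ z = 0 ↔ z ∈ L₂.lattice := fun z ↦ by
    rw [← SetLike.mem_coe, ← hker₂, SetLike.mem_coe, AddMonoidHom.mem_ker]
  obtain ⟨φ, happ, -, hdeg⟩ := exists_isogeny_baseChange_apply_eq_of_forall_mul_mem_lattice
    hL₁.1 hL₁.2 hL₂.1 hL₂.2 hker₁ hsurj₁ hu₁ hker₂ hu₂ hc hle
  exact ⟨φ, u₁, hker₁, hsurj₁, fun z ↦ by rw [happ, hu₂0], hdeg⟩

/-- **Oddness of the degree.**  In the setting of
`exists_isogeny_degree_eq_relIndex_of_isNeronLatticeOf`, if in addition `n·Λ₂ ⊆ cΛ₁` for an ODD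
natural number `n` (so that `ker(z ↦ cz) = c⁻¹Λ₂/Λ₁` is killed by `n`), then there is a
`ℚ`-isogeny `φ : W₁ → W₂` of ODD degree: a finite abelian group killed by an odd `n` has no
element of order `2` (Cauchy), and `deg φ = #ker φ_ℂ`.  (E.g. `Λ₁ = qΛ_f`, `Λ₂ = c₁Λ₁(f)` for a
newform `f` with `pΛ_f ⊆ Λ₁(f) ⊆ Λ_f`, `c = pc₁/q`, `n = p`.)
[cite: SilvermanAEC2009, Thm. VI.4.1] -/
theorem exists_isogeny_odd_degree_of_isNeronLatticeOf
    {W₁ W₂ : WeierstrassCurve ℚ} [W₁.IsElliptic] [W₂.IsElliptic] {L₁ L₂ : PeriodPair}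
    (hL₁ : ModularForms.IsNeronLatticeOf (W₁.baseChange ℂ) L₁)
    (hL₂ : ModularForms.IsNeronLatticeOf (W₂.baseChange ℂ) L₂)
    {c : ℚ} (hc : c ≠ 0) (hle : ∀ z ∈ L₁.lattice, (c : ℂ) * z ∈ L₂.lattice)
    {n : ℕ} (hn : Odd n) (hnle : ∀ w ∈ L₂.lattice, ∃ z ∈ L₁.lattice, (n : ℂ) * w = c * z) :
    ∃ φ : Isogeny W₁ W₂, Odd φ.degree := by
  have hcC : (c : ℂ) ≠ 0 := by exact_mod_cast hc
  obtain ⟨φ, u₁, hker₁, hsurj₁, hkerφ, -⟩ :=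
    exists_isogeny_degree_eq_relIndex_of_isNeronLatticeOf hL₁ hL₂ hc hle
  have hu₁0 : ∀ z, u₁ z = 0 ↔ z ∈ L₁.lattice := fun z ↦ by
    rw [← SetLike.mem_coe, ← hker₁, SetLike.mem_coe, AddMonoidHom.mem_ker]
  refine ⟨φ, ?_⟩
  -- every point of `ker φ_ℂ` is killed by `n`
  have hkill : ∀ P : (φ.baseChange (M := ℂ)).ker, n • P = 0 := by
    rintro ⟨P, hP⟩
    obtain ⟨z, rfl⟩ := hsurj₁ P
    rw [AddMonoidHom.mem_ker] at hP
    obtain ⟨z', hz', hnz⟩ := hnle _ ((hkerφ z).mp hP)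
    have hnz' : (n : ℂ) * z = z' := by
      apply mul_left_cancel₀ hcC
      rw [← hnz]; ring
    apply Subtype.ext
    change n • u₁ z = 0
    rw [← map_nsmul, nsmul_eq_mul, hnz', hu₁0]
    exact hz'
  -- hence `#ker φ_ℂ` is odd (Cauchy)
  rw [← Isogeny.natCard_ker_baseChange_eq_degree (M := ℂ)]
  haveI : Finite (φ.baseChange (M := ℂ)).ker := by
    apply Nat.finite_of_card_ne_zero
    rw [Isogeny.natCard_ker_baseChange_eq_degree]
    exact φ.degree_pos.ne'
  by_contra hodd
  rw [Nat.not_odd_iff_even, even_iff_two_dvd] at hodd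
  obtain ⟨P, hP⟩ := exists_prime_addOrderOf_dvd_card' (G := (φ.baseChange (M := ℂ)).ker) 2 hodd
  have h2 : addOrderOf P ∣ n := addOrderOf_dvd_of_nsmul_eq_zero (hkill P)
  rw [hP] at h2
  exact (Nat.not_even_iff_odd.mpr hn) (even_iff_two_dvd.mpr h2)

end Literature.NumberTheory.EllipticCurves

end
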